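import Summits.AtomisticToContinuum.Crystallization.Theorems.OverbindingBudgetRecurrentSealClosure
import Summits.AtomisticToContinuum.Crystallization.Theorems.OverbindingBudgetRecurrentDustStatements

/-!
# OverbindingBudget — node «RecurrentDust», limit closure I: loosened thin cores and robust violators
(decomp-a2c lens 4, generation 22; helper `--supports stmt-AtomisticToContinuum-31280`; part of the node «RecurrentDust», whose
statement and reading are in `…Theorems.OverbindingBudgetRecurrentDust`)

§N transport along a two-way matching about `0`: `cleanT_of_match'` (robust OR loosened cleanness — the loosened case under the
sliver condition of `cleanT_transport₂`: no site of the target texture at distance in `(1.02a, 1.02a + 2ε]` from the target site, which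
holds INTO a fixed site of the limit for all small `ε`), `rt_of_match` (the relaxed gapped-twelve test crosses a matching with margin
loss `3ε`);  §O `thinCoresL_of_limit`, `violatorsL_of_limit` (the hull conditions `ThinCoresL`, `ViolatorsL` are limit-closed: pigeonhole
the partner site in the limit along `ε → 0⁺`, transport at every margin of the open range). [folklore techniques]
-/

noncomputable section

namespace Summit.AtomisticToContinuum.Crystallization.Theorems.OverbindingBudgetRecurrentDustClosure

open Filter Metric Set Topology
open Literature.MathematicalPhysics.StatisticalMechanics
open Literature.Geometry.DiscreteGeometry (ShellCloseTo fccKissingPattern hcpKissingPattern EtaMatched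
  card_eq_twelve_of_shellCloseTo)
open Summit.AtomisticToContinuum.Crystallization.Theorems.OverbindingBudgetWallTensionLever (CleanT TouchT Linked
  SealedDense MAT ThinCores BarlowClose)
open Summit.AtomisticToContinuum.Crystallization.Theorems.OverbindingBudgetViolatorDensityFloor (GT RT)
open Summit.AtomisticToContinuum.Crystallization.Theorems.OverbindingBudgetGradedBareness (cleanT_anti)
open Summit.AtomisticToContinuum.Crystallization.Theorems.OverbindingBudgetCleanlessCut (margin_le_of_cleanT)
open Summit.AtomisticToContinuum.Crystallization.Theorems.OverbindingBudgetMatchCompactness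
open Summit.AtomisticToContinuum.Crystallization.Theorems.OverbindingBudgetPatchTransportTwo
open Summit.AtomisticToContinuum.Crystallization.Theorems.OverbindingBudgetRecurrentSealStatements
open Summit.AtomisticToContinuum.Crystallization.Theorems.OverbindingBudgetRecurrentSealClosure
open Summit.AtomisticToContinuum.Crystallization.Theorems.OverbindingBudgetRecurrentDustStatements

/-! ## §N  Transport along a two-way matching about `0` -/

/-- The norm of a point near a point of known norm. [folklore] -/
theorem norm_le_of_dist_le {p q : (EuclideanSpace ℝ (Fin 3))} {r : ℝ} (h : dist p q ≤ r) : ‖p‖ ≤ ‖q‖ + r := by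
  have := norm_le_insert' p q
  rw [← dist_eq_norm] at this
  linarith

/-- Cleanness — robust (`0 ≤ t'`) or LOOSENED (`t' < 0`, under the sliver condition: no site of `B` at distance in
`(1.02a, 1.02a + 2ε]` from `y'`) — crosses a two-way `ε`-matching `Match ε R 0 A B` from `y ∈ A` to a partner `y' ∈ B`,
margins `t ↦ t'` with `t' + 2ε ≤ t`, `a t' + 2ε ≤ a t`, `-a/50 ≤ t'` (wrapper of `cleanT_transport₂`, bases `0`). [folklore] -/
theorem cleanT_of_match' {A B : Set (EuclideanSpace ℝ (Fin 3))} {δ ε R a t t' : ℝ} {y y' : (EuclideanSpace ℝ (Fin 3))}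
    (hsepA : ∀ x ∈ A, ∀ z ∈ A, x ≠ z → δ ≤ dist x z) (hsepB : ∀ x ∈ B, ∀ z ∈ B, x ≠ z → δ ≤ dist x z)
    (hε0 : 0 ≤ ε) (hεδ : 2 * ε < δ) (hm : Match ε R 0 A B) (ha : 0 < a) (hεa : 100 * ε ≤ a) (hlo : -(a / 50) ≤ t')
    (hhi : t ≤ a / 50) (htt : t' + 2 * ε ≤ t) (htta : a * t' + 2 * ε ≤ a * t) (hy : y ∈ A) (hy' : y' ∈ B)
    (hyy' : dist y y' ≤ ε) (hR : ‖y‖ + 2 * a ≤ R)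
    (hthr : 0 ≤ t' ∨ ∀ w' ∈ B, w' ≠ y' → dist y' w' ≤ a * (1 + 1 / 50) ∨ a * (1 + 1 / 50) + 2 * ε < dist y' w')
    (hc : CleanT a t A y) : CleanT a t' B y' := by
  have hex₁ : ∀ w ∈ A, dist w 0 ≤ R → ∃ w' ∈ B, dist (w' - 0) (w - 0) ≤ ε := by
    intro w hw hwR
    obtain ⟨w', hw', hd⟩ := hm.2 w hw hwR
    exact ⟨w', hw', by rw [sub_zero, sub_zero, dist_comm]; exact hd⟩
  have hex₂ : ∀ w' ∈ B, dist w' 0 ≤ R → ∃ w ∈ A, dist (w' - 0) (w - 0) ≤ ε := by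
    intro w' hw' hw'R
    obtain ⟨w, hw, hd⟩ := hm.1 w' hw' hw'R
    exact ⟨w, hw, by rw [sub_zero, sub_zero, dist_comm]; exact hd⟩
  have hyy'' : dist (y' - 0) (y - 0) ≤ ε := by rw [sub_zero, sub_zero, dist_comm]; exact hyy'
  have hR' : dist y 0 + 2 * a ≤ R := by rw [dist_zero_right]; exact hR
  exact cleanT_transport₂ hsepA hsepB hε0 hεδ hex₁ hex₂ ha hεa hlo hhi htt htta hy hy' hyy'' hR' hthr hc

/-- **The relaxed gapped-twelve test crosses a matching** with margin loss `3ε`: if `RT a s A y` and `y' ∈ B` is a partner of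
`y ∈ A` under `Match ε R 0 A B`, then `RT a (s + 3ε) B y'`.  (Partners of the points of the open `1.26a`-window of `y'` lie in
the open window of `y`, injectively; the closed `1.02a`-window of `y` injects into that of `y'`; gaps move by `≤ 2ε`.) [folklore] -/
theorem rt_of_match {A B : Set (EuclideanSpace ℝ (Fin 3))} {δ ε R a s : ℝ} {y y' : (EuclideanSpace ℝ (Fin 3))}
    (hsepA : ∀ x ∈ A, ∀ z ∈ A, x ≠ z → δ ≤ dist x z) (hsepB : ∀ x ∈ B, ∀ z ∈ B, x ≠ z → δ ≤ dist x z)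
    (hε0 : 0 ≤ ε) (hεδ : 2 * ε < δ) (hε1 : ε ≤ 1 / 2) (hm : Match ε R 0 A B) (ha : 0 < a) (ha1 : a ≤ 1) (hs : 0 ≤ s)
    (hy : y ∈ A) (hy' : y' ∈ B) (hyy' : dist y y' ≤ ε) (hR : ‖y‖ + s + 4 ≤ R) (h : RT a s A y) :
    RT a (s + 3 * ε) B y' := by
  classical
  obtain ⟨h1, h2, h3⟩ := h
  have hδ : 0 < δ := by linarith
  choose! φ hφA hφd using hm.1
  choose! ψ hψB hψd using hm.2
  have hy'n : ‖y'‖ ≤ ‖y‖ + ε := norm_le_of_dist_le (by rw [dist_comm]; exact hyy')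
  -- partners of nearby sites of `B` lie in `A`, are `ε`-close and are not `y`
  have hφ : ∀ w' ∈ B, w' ≠ y' → dist y' w' ≤ 2 → φ w' ∈ A ∧ dist (φ w') w' ≤ ε ∧ φ w' ≠ y := by
    intro w' hw' hne hd
    have hw'R : dist w' 0 ≤ R := by
      rw [dist_zero_right]
      have := norm_le_of_dist_le (show dist w' y' ≤ 2 by rw [dist_comm]; exact hd)
      linarith
    refine ⟨hφA w' hw' hw'R, hφd w' hw' hw'R, fun heq => ?_⟩
    have hδle := hsepB y' hy' w' hw' (Ne.symm hne)
    have h5 : dist y w' ≤ ε := by rw [← heq]; exact hφd w' hw' hw'R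
    have h4 := dist_triangle y' y w'
    have h6 := dist_comm y' y
    linarith
  -- partners of nearby sites of `A` lie in `B`, are `ε`-close and are not `y'`
  have hψ : ∀ w ∈ A, w ≠ y → dist y w ≤ s + 2 → ψ w ∈ B ∧ dist w (ψ w) ≤ ε ∧ ψ w ≠ y' := by
    intro w hw hne hd
    have hwR : dist w 0 ≤ R := by
      rw [dist_zero_right]
      have := norm_le_of_dist_le (show dist w y ≤ s + 2 by rw [dist_comm]; exact hd)
      linarith
    refine ⟨hψB w hw hwR, hψd w hw hwR, fun heq => ?_⟩
    have hδle := hsepA y hy w hw (Ne.symm hne)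
    have h5 : dist w y' ≤ ε := by rw [← heq]; exact hψd w hw hwR
    have h4 := dist_triangle y y' w
    have h6 := dist_comm w y'
    linarith
  refine ⟨?_, ?_, fun w' hw' hne => ?_⟩
  · -- the open `1.26a - (s + 3ε)`-window of `y'` injects into the open `1.26a - s`-window of `y`
    refine le_trans (Set.ncard_le_ncard_of_injOn φ (fun w' hw' => ?_) (fun w₁ hw₁ w₂ hw₂ heq => ?_)
      (window_finite_lt ⟨δ, hδ, hsepA⟩ y _)) h1
    · obtain ⟨hw'B, hne, hd⟩ := hw'
      have hd2 : dist y' w' ≤ 2 := by nlinarith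
      obtain ⟨hA, hdd, hney⟩ := hφ w' hw'B hne hd2
      refine ⟨hA, hney, ?_⟩
      have h4 := dist_triangle y y' (φ w')
      have h5 := dist_triangle y' w' (φ w')
      have h6 := dist_comm w' (φ w')
      linarith
    · obtain ⟨hw₁B, hne₁, hd₁⟩ := hw₁
      obtain ⟨hw₂B, hne₂, hd₂⟩ := hw₂
      obtain ⟨-, hdd₁, -⟩ := hφ w₁ hw₁B hne₁ (by nlinarith)
      obtain ⟨-, hdd₂, -⟩ := hφ w₂ hw₂B hne₂ (by nlinarith)
      by_contra hne12
      have hδle := hsepB w₁ hw₁B w₂ hw₂B hne12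
      have : dist w₁ w₂ ≤ ε + ε := by
        have h4 := dist_triangle w₁ (φ w₁) w₂
        have h5 : dist (φ w₁) w₂ ≤ ε := by rw [heq]; exact hdd₂
        have h6 : dist w₁ (φ w₁) ≤ ε := by rw [dist_comm]; exact hdd₁
        linarith
      linarith
  · -- the closed `1.02a + s`-window of `y` injects into the closed `1.02a + s + 3ε`-window of `y'`
    refine h2.trans (Set.ncard_le_ncard_of_injOn ψ (fun w hw => ?_) (fun w₁ hw₁ w₂ hw₂ heq => ?_)
      (window_finite ⟨δ, hδ, hsepB⟩ y' _))
    · obtain ⟨hwA, hne, hd⟩ := hw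
      have hd2 : dist y w ≤ s + 2 := by nlinarith
      obtain ⟨hB, hdd, hney⟩ := hψ w hwA hne hd2
      refine ⟨hB, hney, ?_⟩
      have h4 := dist_triangle y' y (ψ w)
      have h5 := dist_triangle y w (ψ w)
      have h6 := dist_comm y' y
      linarith
    · obtain ⟨hw₁A, hne₁, hd₁⟩ := hw₁
      obtain ⟨hw₂A, hne₂, hd₂⟩ := hw₂
      obtain ⟨-, hdd₁, -⟩ := hψ w₁ hw₁A hne₁ (by nlinarith)
      obtain ⟨-, hdd₂, -⟩ := hψ w₂ hw₂A hne₂ (by nlinarith)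
      by_contra hne12
      have hδle := hsepA w₁ hw₁A w₂ hw₂A hne12
      have : dist w₁ w₂ ≤ ε + ε := by
        have h4 := dist_triangle w₁ (ψ w₁) w₂
        have h5 : dist (ψ w₁) w₂ ≤ ε := by rw [heq, dist_comm]; exact hdd₂
        linarith [hdd₁]
      linarith
  · -- gaps
    by_cases hfar : a * (63 / 50) ≤ dist y' w'
    · exact ⟨by nlinarith, Or.inr (by nlinarith)⟩
    · push Not at hfar
      have hd2 : dist y' w' ≤ 2 := by nlinarith
      obtain ⟨hA, hdd, hney⟩ := hφ w' hw' hne hd2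
      obtain ⟨hlo, hdich⟩ := h3 (φ w') hA hney
      have hup : dist y (φ w') ≤ dist y' w' + (ε + ε) := by
        have h4 := dist_triangle y y' (φ w')
        have h5 := dist_triangle y' w' (φ w')
        have h6 := dist_comm w' (φ w')
        linarith
      have hdown : dist y' w' ≤ dist y (φ w') + (ε + ε) := by
        have h4 := dist_triangle y' y w'
        have h5 := dist_triangle y (φ w') w'
        have h6 := dist_comm y' y
        linarith
      refine ⟨by linarith, hdich.imp (fun h => by linarith) (fun h => by linarith)⟩

/-! ## §O  Limit closure of loosened thin cores and of robust violators -/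

/-- Loosened thin cores pass to local limits: pigeonhole the partner of the approximants' core-free site in the (finite) ball of
the limit along `ε → 0⁺`; loosened cleanness at margin `-(s - 3ε)` is transported INTO the fixed limit site at margin `-s`, the
sliver condition holding there for all small `ε`. [folklore] -/
theorem thinCoresL_of_limit {δ a r : ℝ} (hδ : 0 < δ) (ha : 47 / 50 ≤ a) (ha1 : a ≤ 1)
    {Zs : ℕ → Set (EuclideanSpace ℝ (Fin 3))} {Z : Set (EuclideanSpace ℝ (Fin 3))} (hsepk : ∀ k, ∀ p ∈ Zs k, ∀ q ∈ Zs k, p ≠ q → δ ≤ dist p q)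
    (hsep : ∀ p ∈ Z, ∀ q ∈ Z, p ≠ q → δ ≤ dist p q)
    (hconv : ∀ R ε : ℝ, 0 < ε → ∀ᶠ k in atTop, Match ε R 0 (Zs k) Z)
    (hT : ∀ k, ThinCoresL a r (Zs k)) : ThinCoresL a r Z := by
  classical
  have ha0 : 0 < a := by linarith
  intro z
  set R₀ : ℝ := ‖z‖ + |r| + 10 with hR₀
  have hk : ∀ ε : ℝ, ∃ k : ℕ, 0 < ε → Match ε R₀ 0 (Zs k) Z := by
    intro ε
    by_cases hε : 0 < ε
    · obtain ⟨k, hk⟩ := (hconv R₀ ε hε).exists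
      exact ⟨k, fun _ => hk⟩
    · exact ⟨0, fun h => absurd h hε⟩
  choose k hk using hk
  -- the core-free sites of the approximants near `z` and their partners in `Z`
  have hyk : ∀ ε : ℝ, ∃ y : (EuclideanSpace ℝ (Fin 3)), 0 < ε → y ∈ Zs (k ε) ∧ dist z y ≤ r ∧
      ∀ s : ℝ, 0 < s → s < 1 / 100 → CleanT a (-s) (Zs (k ε)) y := by
    intro ε
    by_cases hε : 0 < ε
    · obtain ⟨y, hy, hd, hcl⟩ := hT (k ε) z
      exact ⟨y, fun _ => ⟨hy, hd, hcl⟩⟩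
    · exact ⟨0, fun h => absurd h hε⟩
  choose yk hyk using hyk
  have hyn : ∀ ε, 0 < ε → ‖yk ε‖ ≤ ‖z‖ + |r| := by
    intro ε hε
    have := norm_le_of_dist_le (show dist (yk ε) z ≤ r by rw [dist_comm]; exact (hyk ε hε).2.1)
    linarith [le_abs_self r]
  have hzz : ∀ ε : ℝ, ∃ q : (EuclideanSpace ℝ (Fin 3)), 0 < ε → q ∈ Z ∧ dist (yk ε) q ≤ ε := by
    intro ε
    by_cases hε : 0 < ε
    · obtain ⟨q, hq, hqd⟩ := (hk ε hε).2 _ (hyk ε hε).1 (by rw [dist_zero_right]; linarith [hyn ε hε, abs_nonneg r])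
      exact ⟨q, fun _ => ⟨hq, hqd⟩⟩
    · exact ⟨0, fun h => absurd h hε⟩
  choose zz hzz using hzz
  -- pigeonhole along `ε → 0⁺`
  set S : Set (EuclideanSpace ℝ (Fin 3)) := Z ∩ closedBall z (|r| + 1) with hS
  have hSfin : S.Finite := UniformlyDiscrete.finite_inter_closedBall (X := Z) ⟨δ, hδ, hsep⟩ z (|r| + 1)
  have hzzS : ∀ ε, 0 < ε → ε ≤ 1 → zz ε ∈ S := by
    intro ε hε hε1
    obtain ⟨hq, hqd⟩ := hzz ε hε
    refine ⟨hq, mem_closedBall.2 ?_⟩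
    have h1 := dist_triangle (zz ε) (yk ε) z
    have h2 := dist_comm (zz ε) (yk ε)
    have h3 := dist_comm (yk ε) z
    linarith [(hyk ε hε).2.1, le_abs_self r]
  obtain ⟨q, hqS, hfreq⟩ : ∃ q ∈ S, ∃ᶠ ε in 𝓝[>] (0 : ℝ), zz ε = q := by
    by_contra hno
    push Not at hno
    have h1 : ∀ᶠ ε in 𝓝[>] (0 : ℝ), ∀ q ∈ S, zz ε ≠ q := hSfin.eventually_all.2 fun q hq => hno q hq
    have h2 : ∀ᶠ ε in 𝓝[>] (0 : ℝ), ε < 1 := (eventually_lt_nhds one_pos).filter_mono nhdsWithin_le_nhds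
    have h3 : ∀ᶠ ε in 𝓝[>] (0 : ℝ), 0 < ε := eventually_mem_nhdsWithin
    obtain ⟨ε, hε1, hε2, hε3⟩ := (h1.and (h2.and h3)).exists
    exact hε1 (zz ε) (hzzS ε hε3 hε2.le) rfl
  -- the sliver condition at the fixed limit site `q`, for all small `ε`
  have hqZ : q ∈ Z := hqS.1
  have hTfin : (Z ∩ closedBall q 3).Finite := UniformlyDiscrete.finite_inter_closedBall (X := Z) ⟨δ, hδ, hsep⟩ q 3
  have hsliver : ∀ᶠ ε in 𝓝[>] (0 : ℝ), ∀ w' ∈ Z ∩ closedBall q 3,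
      dist q w' ≤ a * (1 + 1 / 50) ∨ a * (1 + 1 / 50) + 2 * ε < dist q w' := by
    refine hTfin.eventually_all.2 fun w' hw' => ?_
    by_cases hle : dist q w' ≤ a * (1 + 1 / 50)
    · exact Filter.Eventually.of_forall fun ε => Or.inl hle
    · push Not at hle
      have hlt : (0 : ℝ) < (dist q w' - a * (1 + 1 / 50)) / 2 := by linarith
      exact ((eventually_lt_nhds hlt).filter_mono nhdsWithin_le_nhds).mono fun ε h => Or.inr (by linarith)
  have hsmall : ∀ ε₀ : ℝ, 0 < ε₀ → ∃ ε : ℝ, 0 < ε ∧ ε < ε₀ ∧ ε ≤ 1 ∧ zz ε = q ∧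
      ∀ w' ∈ Z ∩ closedBall q 3, dist q w' ≤ a * (1 + 1 / 50) ∨ a * (1 + 1 / 50) + 2 * ε < dist q w' := by
    intro ε₀ hε₀
    have h2 : ∀ᶠ ε in 𝓝[>] (0 : ℝ), ε < ε₀ := (eventually_lt_nhds hε₀).filter_mono nhdsWithin_le_nhds
    have h2' : ∀ᶠ ε in 𝓝[>] (0 : ℝ), ε < 1 := (eventually_lt_nhds one_pos).filter_mono nhdsWithin_le_nhds
    have h3 : ∀ᶠ ε in 𝓝[>] (0 : ℝ), 0 < ε := eventually_mem_nhdsWithin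
    obtain ⟨ε, hz, hlt, hlt1, hpos, hsl⟩ := (hfreq.and_eventually (h2.and (h2'.and (h3.and hsliver)))).exists
    exact ⟨ε, hpos, hlt, hlt1.le, hz, hsl⟩
  refine ⟨q, hqZ, ?_, fun s hs hs1 => ?_⟩
  · -- distance to `z`
    refine le_of_forall_pos_lt_add fun τ hτ => ?_
    obtain ⟨ε, hε, hετ, hε1, hzq, -⟩ := hsmall τ hτ
    obtain ⟨-, hqd⟩ := hzz ε hε
    rw [hzq] at hqd
    have h1 := dist_triangle z (yk ε) q
    linarith [(hyk ε hε).2.1]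
  · -- loosened cleanness at margin `-s`, transported into `q`
    obtain ⟨ε, hε, hεs, hε1, hzq, hsl⟩ := hsmall (min (s / 3) (min (δ / 4) (1 / 200))) (by positivity)
    have hε3 : 3 * ε < s := by
      have := min_le_left (s / 3) (min (δ / 4) (1 / 200)); linarith
    have hεδ : 2 * ε < δ := by
      have := (min_le_right (s / 3) (min (δ / 4) (1 / 200))).trans (min_le_left _ _); linarith
    have hεa : 100 * ε ≤ a := by
      have := (min_le_right (s / 3) (min (δ / 4) (1 / 200))).trans (min_le_right _ _); linarith
    obtain ⟨hy, -, hcl⟩ := hyk ε hε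
    obtain ⟨-, hqd⟩ := hzz ε hε
    rw [hzq] at hqd
    have hcs := hcl (s - 3 * ε) (by linarith) (by linarith)
    have hR1 : ‖yk ε‖ + 2 * a ≤ R₀ := by linarith [hyn ε hε, abs_nonneg r]
    have hthr : (0 : ℝ) ≤ -s ∨ ∀ w' ∈ Z, w' ≠ q → dist q w' ≤ a * (1 + 1 / 50) ∨ a * (1 + 1 / 50) + 2 * ε < dist q w' := by
      refine Or.inr fun w' hw' _ => ?_
      by_cases hw3 : dist q w' ≤ 3
      · exact hsl w' ⟨hw', mem_closedBall.2 (by rw [dist_comm]; exact hw3)⟩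
      · push Not at hw3
        exact Or.inr (by linarith)
    exact cleanT_of_match' (hsepk _) hsep hε.le hεδ (hk ε hε) ha0 hεa (by linarith) (by linarith) (by linarith)
      (by nlinarith) hy hqZ hqd hR1 hthr hcs

/-- Robust violators at every margin below `t`, `L`-densely, pass to local limits: pigeonhole the partner of the approximants'
violator; were the limit site to pass the relaxed test at a margin `s < t`, the test would cross back to the approximant at margin
`s + 3ε < t` (`rt_of_match`). [folklore] -/
theorem violatorsL_of_limit {δ a t L : ℝ} (hδ : 0 < δ) (ha : 47 / 50 ≤ a) (ha1 : a ≤ 1)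
    {Zs : ℕ → Set (EuclideanSpace ℝ (Fin 3))} {Z : Set (EuclideanSpace ℝ (Fin 3))} (hsepk : ∀ k, ∀ p ∈ Zs k, ∀ q ∈ Zs k, p ≠ q → δ ≤ dist p q)
    (hsep : ∀ p ∈ Z, ∀ q ∈ Z, p ≠ q → δ ≤ dist p q)
    (hconv : ∀ R ε : ℝ, 0 < ε → ∀ᶠ k in atTop, Match ε R 0 (Zs k) Z)
    (hV : ∀ k, ViolatorsL a t L (Zs k)) : ViolatorsL a t L Z := by
  classical
  have ha0 : 0 < a := by linarith
  intro p hp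
  set R₀ : ℝ := ‖p‖ + |L| + |t| + 10 with hR₀
  have hk : ∀ ε : ℝ, ∃ k : ℕ, 0 < ε → Match ε R₀ 0 (Zs k) Z := by
    intro ε
    by_cases hε : 0 < ε
    · obtain ⟨k, hk⟩ := (hconv R₀ ε hε).exists
      exact ⟨k, fun _ => hk⟩
    · exact ⟨0, fun h => absurd h hε⟩
  choose k hk using hk
  have hp0 : dist p 0 ≤ R₀ := by
    rw [dist_zero_right]; linarith [abs_nonneg L, abs_nonneg t, norm_nonneg p]
  -- partners of `p`, the violators near them, and their partners back in `Z`
  have hpn : ∀ ε : ℝ, ∃ q : (EuclideanSpace ℝ (Fin 3)), 0 < ε → q ∈ Zs (k ε) ∧ dist q p ≤ ε := by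
    intro ε
    by_cases hε : 0 < ε
    · obtain ⟨q, hq, hqd⟩ := (hk ε hε).1 p hp hp0
      exact ⟨q, fun _ => ⟨hq, hqd⟩⟩
    · exact ⟨0, fun h => absurd h hε⟩
  choose pn hpn using hpn
  have hyk : ∀ ε : ℝ, ∃ y : (EuclideanSpace ℝ (Fin 3)), 0 < ε → y ∈ Zs (k ε) ∧ dist y (pn ε) ≤ L ∧
      ∀ s : ℝ, 0 < s → s < t → ¬ RT a s (Zs (k ε)) y := by
    intro ε
    by_cases hε : 0 < ε
    · obtain ⟨y, hy, hd, hn⟩ := hV (k ε) (pn ε) (hpn ε hε).1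
      exact ⟨y, fun _ => ⟨hy, hd, hn⟩⟩
    · exact ⟨0, fun h => absurd h hε⟩
  choose yk hyk using hyk
  have hyn : ∀ ε, 0 < ε → ε ≤ 1 → ‖yk ε‖ ≤ ‖p‖ + |L| + 1 := by
    intro ε hε hε1
    have h1 := norm_le_of_dist_le (hyk ε hε).2.1
    have h2 := norm_le_of_dist_le (hpn ε hε).2
    linarith [le_abs_self L]
  have hzz : ∀ ε : ℝ, ∃ q : (EuclideanSpace ℝ (Fin 3)), 0 < ε → ε ≤ 1 → q ∈ Z ∧ dist (yk ε) q ≤ ε := by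
    intro ε
    by_cases hε : 0 < ε
    · by_cases hε1 : ε ≤ 1
      · obtain ⟨q, hq, hqd⟩ := (hk ε hε).2 _ (hyk ε hε).1
          (by rw [dist_zero_right]; linarith [hyn ε hε hε1, abs_nonneg L, abs_nonneg t])
        exact ⟨q, fun _ _ => ⟨hq, hqd⟩⟩
      · exact ⟨0, fun _ h => absurd h hε1⟩
    · exact ⟨0, fun h => absurd h hε⟩
  choose zz hzz using hzz
  -- pigeonhole along `ε → 0⁺`
  set S : Set (EuclideanSpace ℝ (Fin 3)) := Z ∩ closedBall p (|L| + 2) with hS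
  have hSfin : S.Finite := UniformlyDiscrete.finite_inter_closedBall (X := Z) ⟨δ, hδ, hsep⟩ p (|L| + 2)
  have hzzS : ∀ ε, 0 < ε → ε ≤ 1 → zz ε ∈ S := by
    intro ε hε hε1
    obtain ⟨hq, hqd⟩ := hzz ε hε hε1
    refine ⟨hq, mem_closedBall.2 ?_⟩
    have h1 := dist_triangle (zz ε) (yk ε) p
    have h2 := dist_triangle (yk ε) (pn ε) p
    have h3 := dist_comm (zz ε) (yk ε)
    linarith [(hyk ε hε).2.1, (hpn ε hε).2, le_abs_self L]
  obtain ⟨q, hqS, hfreq⟩ : ∃ q ∈ S, ∃ᶠ ε in 𝓝[>] (0 : ℝ), zz ε = q := by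
    by_contra hno
    push Not at hno
    have h1 : ∀ᶠ ε in 𝓝[>] (0 : ℝ), ∀ q ∈ S, zz ε ≠ q := hSfin.eventually_all.2 fun q hq => hno q hq
    have h2 : ∀ᶠ ε in 𝓝[>] (0 : ℝ), ε < 1 := (eventually_lt_nhds one_pos).filter_mono nhdsWithin_le_nhds
    have h3 : ∀ᶠ ε in 𝓝[>] (0 : ℝ), 0 < ε := eventually_mem_nhdsWithin
    obtain ⟨ε, hε1, hε2, hε3⟩ := (h1.and (h2.and h3)).exists
    exact hε1 (zz ε) (hzzS ε hε3 hε2.le) rfl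
  have hsmall : ∀ ε₀ : ℝ, 0 < ε₀ → ∃ ε : ℝ, 0 < ε ∧ ε < ε₀ ∧ ε ≤ 1 ∧ zz ε = q := by
    intro ε₀ hε₀
    have h2 : ∀ᶠ ε in 𝓝[>] (0 : ℝ), ε < ε₀ := (eventually_lt_nhds hε₀).filter_mono nhdsWithin_le_nhds
    have h2' : ∀ᶠ ε in 𝓝[>] (0 : ℝ), ε < 1 := (eventually_lt_nhds one_pos).filter_mono nhdsWithin_le_nhds
    have h3 : ∀ᶠ ε in 𝓝[>] (0 : ℝ), 0 < ε := eventually_mem_nhdsWithin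
    obtain ⟨ε, hz, hlt, hlt1, hpos⟩ := (hfreq.and_eventually (h2.and (h2'.and h3))).exists
    exact ⟨ε, hpos, hlt, hlt1.le, hz⟩
  have hqZ : q ∈ Z := hqS.1
  have hqn : ‖q‖ ≤ ‖p‖ + |L| + 2 := by
    have := norm_le_of_dist_le (mem_closedBall.1 hqS.2)
    linarith
  refine ⟨q, hqZ, ?_, fun s hs hst hRT => ?_⟩
  · -- distance to `p`
    refine le_of_forall_pos_lt_add fun τ hτ => ?_
    obtain ⟨ε, hε, hετ, hε1, hzq⟩ := hsmall (τ / 2) (by linarith)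
    obtain ⟨-, hqd⟩ := hzz ε hε hε1
    rw [hzq] at hqd
    have h1 := dist_triangle q (yk ε) p
    have h2 := dist_triangle (yk ε) (pn ε) p
    have h3 := dist_comm q (yk ε)
    linarith [(hyk ε hε).2.1, (hpn ε hε).2]
  · -- a pass of the relaxed test at `q` would cross to the approximant's violator
    obtain ⟨ε, hε, hεs, hε1, hzq⟩ := hsmall (min ((t - s) / 3) (min (δ / 4) (1 / 2))) (by positivity)
    have hε3 : 3 * ε < t - s := by
      have := min_le_left ((t - s) / 3) (min (δ / 4) (1 / 2)); linarith
    have hεδ : 2 * ε < δ := by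
      have := (min_le_right ((t - s) / 3) (min (δ / 4) (1 / 2))).trans (min_le_left _ _); linarith
    have hε2 : ε ≤ 1 / 2 := by
      have := (min_le_right ((t - s) / 3) (min (δ / 4) (1 / 2))).trans (min_le_right _ _); linarith
    obtain ⟨hy, -, hn⟩ := hyk ε hε
    obtain ⟨-, hqd⟩ := hzz ε hε hε1
    rw [hzq] at hqd
    have hR1 : ‖q‖ + s + 4 ≤ R₀ := by
      have : s ≤ |t| := by linarith [le_abs_self t]
      linarith [abs_nonneg L]
    exact hn (s + 3 * ε) (by linarith) (by linarith)
      (rt_of_match hsep (hsepk _) hε.le hεδ hε2 (hk ε hε).symm ha0 ha1 hs.le hqZ hy (by rw [dist_comm]; exact hqd) hR1 hRT)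

end Summit.AtomisticToContinuum.Crystallization.Theorems.OverbindingBudgetRecurrentDustClosure

end
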